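import Summits.CriticalPhenomena.Ising3D.TaylorTableOddHeadParts2
import Summits.CriticalPhenomena.Ising3D.TaylorTableOddHeadScalars2
import HarnessLib

/-!
# XXXIc: remainder Horner bound, `oddCoreM2_sound`, `posOnOddM2_sound`, `famRem_core`, `famRem_sound`, `scalar_exp_decomp`
(cell `pub-ising3x`, seat boot-1 gen 15/16; the MERGED-2 (first-order) odd-head test chain, landed per LEAN-PLAN-MERGED2 in ten modules)

HONEST FRAMING: lottery ticket; floor = tightest certified 3D Ising CFT bounds; no exact-solution
claim without a proof. Island framing: certified exclusion region at stated derivative order and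
assumptions; not a determination of the 3D Ising critical exponents beyond that.

Drafted and kernel-checked as one combined file (oddtest2/lean-draft/Merged2CellCombined.lean, 83 theorems, standard axioms); landed in slices of ≤ 400 lines. [folklore]
-/

namespace Summit.CriticalPhenomena.Ising3D

open Finset Set
open Literature.Analysis.ValidatedNumerics Literature.Analysis.ValidatedNumerics.PolyMP
open Literature.Analysis.ValidatedNumerics.NumericsMP
open Literature.MathematicalPhysics.QuantumFieldTheory.ConformalBootstrap3D
open Literature.MathematicalPhysics.QuantumFieldTheory.ConformalBootstrap3D.HRTM
open Literature.MathematicalPhysics.QuantumFieldTheory.ConformalBootstrap3D.PointKernel (mulQ mem_mulQ legendreLamQ)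

namespace HeadParts2

open HRTMAB2 (T3 rowEntry2)

/-! ### The one new analytic lemma of the final layer: the absolute-remainder Horner bound (`remAbsR` itself is defined in XXXIb) -/

/-- **`remAbsR ≤ remAbsB / S`**: if every `r_k · S ≤ hi_k` (membership in the claim polynomial) and `0 ≤ m`, then
`(Σ_k r_k m^k) · S ≤ remAbsB P m`. This is the bound the merged-2 final uses for `|Rem(ρ)| ≤ Σ_k r_k |ρ|^k` with `m = max |lo| |hi|`. [folklore] -/
theorem remAbsR_le {S : ℕ} {m : ℚ} (hm : 0 ≤ m) :
    ∀ {rs : List ℝ} {P : IPoly}, PMem S rs P → remAbsR rs m * S ≤ (remAbsB P m : ℝ)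
  | _, _, List.Forall₂.nil => by simp [remAbsR, remAbsB]
  | _, _, List.Forall₂.cons (a := r) (b := I) h t => by
      have ih := remAbsR_le hm t
      have hr : r * S ≤ (I.hi : ℝ) := h.2
      have hm' : (0 : ℝ) ≤ (m : ℝ) := by exact_mod_cast hm
      simp only [remAbsR, remAbsB, Rat.cast_add, Rat.cast_mul, Rat.cast_intCast]
      have : (m : ℝ) * (remAbsR _ m * S) ≤ (m : ℝ) * (remAbsB _ m : ℝ) := mul_le_mul_of_nonneg_left ih hm'
      nlinarith [this, hr]

/-- Nonnegativity of the real Horner sum for nonnegative coefficients and argument. [folklore] -/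
theorem remAbsR_nonneg : ∀ {rs : List ℝ}, (∀ r ∈ rs, 0 ≤ r) → ∀ {m : ℝ}, 0 ≤ m → 0 ≤ remAbsR rs m
  | [], _, _, _ => by simp [remAbsR]
  | r :: rs, h, m, hm => by
      simp only [remAbsR]
      have h0 : 0 ≤ r := h r (by simp)
      have h1 := remAbsR_nonneg (rs := rs) (fun r' hr' => h r' (by simp [hr'])) hm
      positivity

/-- Monotonicity in the (nonnegative) argument. [folklore] -/
theorem remAbsR_mono : ∀ {rs : List ℝ}, (∀ r ∈ rs, 0 ≤ r) → ∀ {m m' : ℝ}, 0 ≤ m → m ≤ m' → remAbsR rs m ≤ remAbsR rs m'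
  | [], _, _, _, _, _ => by simp [remAbsR]
  | r :: rs, h, m, m', hm, hmm => by
      simp only [remAbsR]
      have hrs : ∀ r' ∈ rs, 0 ≤ r' := fun r' hr' => h r' (by simp [hr'])
      have h1 := remAbsR_mono hrs hm hmm
      have h2 := remAbsR_nonneg hrs hm
      have h3 := remAbsR_nonneg hrs (le_trans hm hmm)
      nlinarith [mul_le_mul hmm h1 h2 (le_trans hm hmm)]

/-- **Pointwise form**: for `|ρ| ≤ m` and nonnegative `r_k` with `r_k · S ≤ hi_k`, `(Σ_k r_k |ρ|^k) · S ≤ remAbsB P m`. [folklore] -/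
theorem remAbsR_abs_le {S : ℕ} {m : ℚ} {ρ : ℝ} (hρ : |ρ| ≤ m) {rs : List ℝ} {P : IPoly} (h : PMem S rs P)
    (hnn : ∀ r ∈ rs, 0 ≤ r) : remAbsR rs |ρ| * S ≤ (remAbsB P m : ℝ) := by
  have hm : (0 : ℝ) ≤ (m : ℝ) := le_trans (abs_nonneg ρ) hρ
  have h1 := remAbsR_mono hnn (abs_nonneg ρ) hρ
  have h2 := remAbsR_le (S := S) (m := m) (by exact_mod_cast hm) h
  have hS : (0 : ℝ) ≤ (S : ℝ) := by positivity
  nlinarith [mul_le_mul_of_nonneg_right h1 hS]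

/-! ### Soundness of the merged-2 final test (LEAN-PLAN item 4 core) -/

/-- `|ρ| ≤ max |lo| |hi|` on `[lo, hi]`. [folklore] -/
theorem abs_le_max_of_mem {lo hi : ℚ} {ρ : ℝ} (hlo : (lo : ℝ) ≤ ρ) (hhi : ρ ≤ hi) :
    |ρ| ≤ ((max |lo| |hi| : ℚ) : ℝ) := by
  push_cast
  rcases le_or_gt 0 ρ with h | h
  · rw [abs_of_nonneg h]
    exact le_trans (le_trans hhi (le_abs_self _)) (le_max_right _ _)
  · rw [abs_of_neg h]
    have : -ρ ≤ |(lo : ℝ)| := le_trans (by linarith) (neg_le_abs _)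
    exact le_trans this (le_max_left _ _)

/-- **Soundness of the merged-2 core test.** If the test passes on `[lo, hi]` and the value decomposes as
`v = B₀(ρ) + x·B_x(ρ) + y·B_y(ρ) + R` with member coefficient lists of the four claims, `|x| ≤ Wσ`, `|y| ≤ Wε` and
`|R| ≤ Σ_k r_k |ρ|^k` with nonnegative `r_k` in the remainder claim, then `0 < v`. [folklore] -/
theorem oddCoreM2_sound {S : ℕ} (hS : 0 < S) {B0 Bx By Rm : IPoly} {Ws We lo hi : ℚ}
    (h : oddCoreM2 S B0 Bx By Rm Ws We lo hi = true)
    {x y ρ : ℝ} (hx : |x| ≤ Ws) (hy : |y| ≤ We) (hlo : (lo : ℝ) ≤ ρ) (hhi : ρ ≤ hi)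
    {b0s bxs bys rs : List ℝ} (m0 : PMem S b0s B0) (mx : PMem S bxs Bx) (my : PMem S bys By) (mr : PMem S rs Rm)
    (hrnn : ∀ r ∈ rs, 0 ≤ r) {v R : ℝ} (hv : v = evalR b0s ρ + x * evalR bxs ρ + y * evalR bys ρ + R)
    (hR : |R| ≤ remAbsR rs |ρ|) : 0 < v := by
  simp only [oddCoreM2, decide_eq_true_eq] at h
  have hSr : (0 : ℝ) < S := by exact_mod_cast hS
  have e0 := lowB_le hS m0 hlo hhi
  have ex := abs_le_absB hS mx hlo hhi
  have ey := abs_le_absB hS my hlo hhi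
  have er := remAbsR_abs_le (abs_le_max_of_mem hlo hhi) mr hrnn
  have hd : (Ws : ℝ) * (absB S Bx lo hi : ℝ) + (We : ℝ) * (absB S By lo hi : ℝ) + ((remAbsB Rm (max |lo| |hi|) : ℚ) : ℝ) <
      (lowB S B0 lo hi : ℝ) := by exact_mod_cast h
  -- |x·bx| S ≤ Ws absB, |y·by| S ≤ We absB, |R| S ≤ remAbsB
  have hWs : 0 ≤ (Ws : ℝ) := le_trans (abs_nonneg x) hx
  have hWe : 0 ≤ (We : ℝ) := le_trans (abs_nonneg y) hy
  have bx' : |x * evalR bxs ρ| * S ≤ (Ws : ℝ) * (absB S Bx lo hi : ℝ) := by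
    rw [abs_mul, mul_assoc]
    exact mul_le_mul hx ex (by positivity) hWs
  have by' : |y * evalR bys ρ| * S ≤ (We : ℝ) * (absB S By lo hi : ℝ) := by
    rw [abs_mul, mul_assoc]
    exact mul_le_mul hy ey (by positivity) hWe
  have br : |R| * S ≤ ((remAbsB Rm (max |lo| |hi|) : ℚ) : ℝ) :=
    le_trans (mul_le_mul_of_nonneg_right hR hSr.le) er
  have key : 0 < v * S := by
    rw [hv]
    have h1 := neg_abs_le (x * evalR bxs ρ)
    have h2 := neg_abs_le (y * evalR bys ρ)
    have h3 := neg_abs_le R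
    nlinarith [e0, bx', by', br, hd, h1, h2, h3, abs_nonneg (x * evalR bxs ρ), abs_nonneg (y * evalR bys ρ), abs_nonneg R]
  exact (mul_pos_iff_of_pos_right hSr).mp key

/-- **Soundness of the bisected merged-2 test** (POINTWISE data, shape of `posOnOddM_sound`: the member lists and the remainder
bound are those valid at the given `ρ`; the recursion descends to the bisection leaf containing `ρ`). [folklore] -/
theorem posOnOddM2_sound {S : ℕ} (hS : 0 < S) {B0 Bx By Rm : IPoly} {Ws We : ℚ}
    {x y ρ : ℝ} (hx : |x| ≤ Ws) (hy : |y| ≤ We)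
    {b0s bxs bys rs : List ℝ} (m0 : PMem S b0s B0) (mx : PMem S bxs Bx) (my : PMem S bys By) (mr : PMem S rs Rm)
    (hrnn : ∀ r ∈ rs, 0 ≤ r) {v R : ℝ}
    (hv : v = evalR b0s ρ + x * evalR bxs ρ + y * evalR bys ρ + R) (hR : |R| ≤ remAbsR rs |ρ|) :
    ∀ {d : ℕ} {lo hi : ℚ}, posOnOddM2 S B0 Bx By Rm Ws We d lo hi = true → (lo : ℝ) ≤ ρ → ρ ≤ hi → 0 < v
  | 0, _, _, h, hlo, hhi => oddCoreM2_sound hS h hx hy hlo hhi m0 mx my mr hrnn hv hR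
  | d + 1, a, b, h, hlo, hhi => by
      simp only [posOnOddM2, Bool.or_eq_true, Bool.and_eq_true] at h
      rcases h with h | ⟨ha, hb⟩
      · exact oddCoreM2_sound hS h hx hy hlo hhi m0 mx my mr hrnn hv hR
      · have hmR : (((a + b) / 2 : ℚ) : ℝ) = ((a : ℝ) + b) / 2 := by push_cast; ring
        rcases le_or_gt ρ (((a : ℝ) + b) / 2) with hρ | hρ
        · exact posOnOddM2_sound hS hx hy m0 mx my mr hrnn hv hR ha hlo (by rw [hmR]; exact hρ)
        · exact posOnOddM2_sound hS hx hy m0 mx my mr hrnn hv hR hb (by rw [hmR]; exact hρ.le) hhi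


/-! ### Soundness of the per-family second-order remainder `famRem` (LEAN-PLAN item 2, core) -/

/-- `remAbsR` IS Horner evaluation (same recursion as `evalR`). [folklore] -/
theorem remAbsR_eq_evalR : ∀ (rs : List ℝ) (m : ℝ), remAbsR rs m = evalR rs m
  | [], _ => rfl
  | r :: rs, m => by simp only [remAbsR, evalR_cons, remAbsR_eq_evalR rs m]

/-- `|Σ a_k ρ^k| ≤ Σ |a_k| |ρ|^k` with `evalR` on the right. [folklore] -/
theorem abs_evalR_le (ρ : ℝ) (as : List ℝ) : |evalR as ρ| ≤ evalR (as.map fun a => |a|) |ρ| := by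
  have h := abs_evalR_le_remAbsR ρ as
  rwa [remAbsR_eq_evalR] at h

/-- `|a·b| ≤ A·B` from `|a| ≤ A`, `|b| ≤ B` (file-local: the same one-liner is landed elsewhere in the tree under other names; kept private
to avoid an unrelated import — gate dedup.landed 2026-08-25). [folklore] -/
private theorem abs_mul_le_of {a b A B : ℝ} (ha : |a| ≤ A) (hb : |b| ≤ B) : |a * b| ≤ A * B := by
  rw [abs_mul]; exact mul_le_mul ha hb (abs_nonneg _) (le_trans (abs_nonneg _) ha)

/-- Entries of `addR` of nonnegative lists are nonnegative. [folklore] -/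
theorem addR_nonneg : ∀ {as bs : List ℝ}, (∀ r ∈ as, 0 ≤ r) → (∀ r ∈ bs, 0 ≤ r) → ∀ r ∈ addR as bs, 0 ≤ r
  | [], bs, _, hb => by simpa [addR] using hb
  | a :: as, [], ha, _ => by simpa [addR] using ha
  | a :: as, b :: bs, ha, hb => by
      intro r hr
      simp only [addR, List.mem_cons] at hr
      rcases hr with rfl | hr
      · exact add_nonneg (ha a (by simp)) (hb b (by simp))
      · exact addR_nonneg (fun r' h' => ha r' (by simp [h'])) (fun r' h' => hb r' (by simp [h'])) r hr

/-- Entries of `smulR c` (`0 ≤ c`) of a nonnegative list are nonnegative. [folklore] -/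
theorem smulR_nonneg {c : ℝ} (hc : 0 ≤ c) {as : List ℝ} (ha : ∀ r ∈ as, 0 ≤ r) : ∀ r ∈ smulR c as, 0 ≤ r := by
  intro r hr
  simp only [smulR, List.mem_map] at hr
  obtain ⟨a, ha', rfl⟩ := hr
  exact mul_nonneg hc (ha a ha')

/-- Entries of `mulR` of nonnegative lists are nonnegative. [folklore] -/
theorem mulR_nonneg : ∀ {as bs : List ℝ}, (∀ r ∈ as, 0 ≤ r) → (∀ r ∈ bs, 0 ≤ r) → ∀ r ∈ mulR as bs, 0 ≤ r
  | [], bs, _, _ => by simp [mulR]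
  | a :: as, bs, ha, hb => by
      simp only [mulR]
      refine addR_nonneg (smulR_nonneg (ha a (by simp)) hb) ?_
      intro r hr
      simp only [List.mem_cons] at hr
      rcases hr with rfl | hr
      · exact le_refl 0
      · exact mulR_nonneg (fun r' h' => ha r' (by simp [h'])) hb r hr

/-- Entries `|c_k| τ²` are nonnegative. [folklore] -/
theorem nonneg_of_map_abs_sq (τ : ℝ) (m2 : List ℝ) : ∀ r ∈ m2.map (fun c => |c| * τ ^ 2), 0 ≤ r := by
  intro r hr
  obtain ⟨a, _, rfl⟩ := List.mem_map.mp hr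
  exact mul_nonneg (abs_nonneg a) (sq_nonneg τ)

/-- `|τ² · Σ c_k ρ^k| ≤ Σ (|c_k| τ²) |ρ|^k`. [folklore] -/
theorem abs_sq_evalR_le (τ ρ : ℝ) (m2 : List ℝ) :
    |τ ^ 2 * evalR m2 ρ| ≤ evalR (m2.map fun c => |c| * τ ^ 2) |ρ| := by
  have h := abs_evalR_le ρ (smulR (τ ^ 2) m2)
  rw [evalR_smulR] at h
  have e : (smulR (τ ^ 2) m2).map (fun a => |a|) = m2.map (fun c => |c| * τ ^ 2) := by
    simp only [smulR, List.map_map]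
    refine List.map_congr_left (fun c _ => ?_)
    simp only [Function.comp, abs_mul, abs_pow, sq_abs]; ring
  rw [e] at h; exact h

/-- **The bilinear second-order bookkeeping** (pure real inequality behind `famRem`): with `|X_i| ≤ A_i` (literal orders, widths
folded), `|Y_i| ≤ B_i` (table slots), scalar `c₀(1+u) + r₂`, `|u| ≤ U`, `|r₂| ≤ |c₀| U²`, `|c₀| ≤ C`:
`|c·l·e − [c₀X₀Y₀ + c₀(X₁Y₀ + X₀Y₁) + c₀uX₀Y₀]| ≤ C·Q + C·U·(A₁B₀ + A₀B₁ + Q) + C·U·U·(ΣA)(ΣB)`,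
`Q = A₀B₂ + A₁B₁ + A₂(B₀+B₁+B₂) + A₁B₂`. [folklore] -/
theorem famRem_core {X0 X1 X2 Y0 Y1 Y2 A0 A1 A2 B0 B1 B2 c0 u r2 C U : ℝ}
    (hX0 : |X0| ≤ A0) (hX1 : |X1| ≤ A1) (hX2 : |X2| ≤ A2) (hY0 : |Y0| ≤ B0) (hY1 : |Y1| ≤ B1) (hY2 : |Y2| ≤ B2)
    (hu : |u| ≤ U) (hr2 : |r2| ≤ |c0| * U ^ 2) (hc0 : |c0| ≤ C) :
    |(c0 * (1 + u) + r2) * (X0 + X1 + X2) * (Y0 + Y1 + Y2)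
        - (c0 * (X0 * Y0) + c0 * (X1 * Y0 + X0 * Y1) + c0 * u * (X0 * Y0))|
      ≤ C * (A0 * B2 + A1 * B1 + A2 * (B0 + B1 + B2) + A1 * B2)
        + C * U * (A1 * B0 + A0 * B1 + (A0 * B2 + A1 * B1 + A2 * (B0 + B1 + B2) + A1 * B2))
        + C * U * U * ((A0 + A1 + A2) * (B0 + B1 + B2)) := by
  have hUn : 0 ≤ U := le_trans (abs_nonneg _) hu
  have hCn : 0 ≤ C := le_trans (abs_nonneg _) hc0
  -- the bracket sums
  have hl : |X0 + X1 + X2| ≤ A0 + A1 + A2 := by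
    rw [abs_le] at hX0 hX1 hX2 ⊢; constructor <;> linarith [hX0.1, hX1.1, hX2.1, hX0.2, hX1.2, hX2.2]
  have he : |Y0 + Y1 + Y2| ≤ B0 + B1 + B2 := by
    rw [abs_le] at hY0 hY1 hY2 ⊢; constructor <;> linarith [hY0.1, hY1.1, hY2.1, hY0.2, hY1.2, hY2.2]
  -- the degree-≥2 part of `l·e`
  set Qr : ℝ := X0 * Y2 + X1 * Y1 + X2 * (Y0 + Y1 + Y2) + X1 * Y2 with hQr
  set Q : ℝ := A0 * B2 + A1 * B1 + A2 * (B0 + B1 + B2) + A1 * B2 with hQ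
  have t1 := abs_mul_le_of hX0 hY2
  have t2 := abs_mul_le_of hX1 hY1
  have t3 := abs_mul_le_of hX2 he
  have t4 := abs_mul_le_of hX1 hY2
  have hQr' : |Qr| ≤ Q := by
    rw [hQr, hQ]
    rw [abs_le] at t1 t2 t3 t4 ⊢; constructor <;> linarith [t1.1, t2.1, t3.1, t4.1, t1.2, t2.2, t3.2, t4.2]
  -- the four error terms
  have b1 : |c0 * Qr| ≤ C * Q := abs_mul_le_of hc0 hQr'
  have hcu : |c0 * u| ≤ C * U := abs_mul_le_of hc0 hu
  have t5 := abs_mul_le_of hX1 hY0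
  have t6 := abs_mul_le_of hX0 hY1
  have h10 : |X1 * Y0 + X0 * Y1| ≤ A1 * B0 + A0 * B1 := by
    rw [abs_le] at t5 t6 ⊢; constructor <;> linarith [t5.1, t6.1, t5.2, t6.2]
  have b2 : |c0 * u * (X1 * Y0 + X0 * Y1)| ≤ C * U * (A1 * B0 + A0 * B1) := abs_mul_le_of hcu h10
  have b3 : |c0 * u * Qr| ≤ C * U * Q := abs_mul_le_of hcu hQr'
  have hr2' : |r2| ≤ C * U * U := by
    have : |c0| * U ^ 2 ≤ C * U ^ 2 := mul_le_mul_of_nonneg_right hc0 (sq_nonneg U)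
    nlinarith [this, hr2]
  have hle : |(X0 + X1 + X2) * (Y0 + Y1 + Y2)| ≤ (A0 + A1 + A2) * (B0 + B1 + B2) := abs_mul_le_of hl he
  have b4 : |r2 * ((X0 + X1 + X2) * (Y0 + Y1 + Y2))| ≤ C * U * U * ((A0 + A1 + A2) * (B0 + B1 + B2)) :=
    abs_mul_le_of hr2' hle
  have hD : (c0 * (1 + u) + r2) * (X0 + X1 + X2) * (Y0 + Y1 + Y2)
        - (c0 * (X0 * Y0) + c0 * (X1 * Y0 + X0 * Y1) + c0 * u * (X0 * Y0))
      = c0 * Qr + c0 * u * (X1 * Y0 + X0 * Y1) + c0 * u * Qr + r2 * ((X0 + X1 + X2) * (Y0 + Y1 + Y2)) := by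
    rw [hQr]; ring
  rw [hD]
  rw [abs_le] at b1 b2 b3 b4 ⊢; constructor <;> linarith [b1.1, b2.1, b3.1, b4.1, b1.2, b2.2, b3.2, b4.2]

/-- **Soundness of `famRem`** (one family, pointwise in the box point and `ρ`): literal `δ`-structure `l = l₀ + δ l₁ + δ² l₂`
(`|δ| ≤ Wu`), table `τ`-structure `e = m₀ + τ m₁ + τ² m₂(τ)` (`|τ| ≤ Wt`, the `τ²` column given through its folded bound
list), scalar `c = c₀(1+u) + r₂` (`|u| ≤ U`, `|r₂| ≤ |c₀|U²`, `|c₀| ≤ Cabs`; `varies = false` forces `u = r₂ = 0`): the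
second-order remainder of `c·l·e` after its `B₀ / first-order` parts is bounded by the absolute Horner value of a NONNEGATIVE
member list of `famRem`. [folklore] -/
theorem famRem_sound {S : ℕ} (hS : 0 < S) {U Wu Wt Cabs : ℚ} {varies : Bool}
    {L0 L1 L2 M0 M1 M2 : IPoly} {l0 l1 l2 m0 m1 m2 : List ℝ} {τ δ ρ : ℝ}
    (hl0 : PMem S l0 L0) (hl1 : PMem S l1 L1) (hl2 : PMem S l2 L2)
    (hm0 : PMem S m0 M0) (hm1 : PMem S m1 M1) (hm2 : PMem S (m2.map fun c => |c| * τ ^ 2) M2)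
    (hδ : |δ| ≤ (Wu : ℝ)) (hτ : |τ| ≤ (Wt : ℝ))
    {c c0 u r2 : ℝ} (hc : c = c0 * (1 + u) + r2) (hu : |u| ≤ (U : ℝ)) (hr2 : |r2| ≤ |c0| * (U : ℝ) ^ 2)
    (hc0 : |c0| ≤ (Cabs : ℝ)) (hvar : varies = false → u = 0 ∧ r2 = 0) :
    ∃ rr : List ℝ, PMem S rr (famRem S U Wu Wt Cabs varies L0 L1 L2 M0 M1 M2) ∧ (∀ r ∈ rr, 0 ≤ r) ∧
      |c * (evalR l0 ρ + δ * evalR l1 ρ + δ ^ 2 * evalR l2 ρ) * (evalR m0 ρ + τ * evalR m1 ρ + τ ^ 2 * evalR m2 ρ)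
        - (c0 * (evalR l0 ρ * evalR m0 ρ) + c0 * (δ * evalR l1 ρ * evalR m0 ρ + evalR l0 ρ * (τ * evalR m1 ρ))
            + c0 * u * (evalR l0 ρ * evalR m0 ρ))| ≤ remAbsR rr |ρ| := by
  subst hc
  have hUn : (0 : ℝ) ≤ (U : ℝ) := le_trans (abs_nonneg _) hu
  have hWu : (0 : ℝ) ≤ (Wu : ℝ) := le_trans (abs_nonneg _) hδ
  have hWt : (0 : ℝ) ≤ (Wt : ℝ) := le_trans (abs_nonneg _) hτ
  have hCn : (0 : ℝ) ≤ (Cabs : ℝ) := le_trans (abs_nonneg _) hc0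
  -- real shadows of famRem's lists
  set al0 : List ℝ := l0.map (fun a => |a|) with hal0
  set al1 : List ℝ := smulR (Wu : ℝ) (l1.map fun a => |a|) with hal1
  set al2 : List ℝ := smulR (((Wu ^ 2 : ℚ) : ℝ)) (l2.map fun a => |a|) with hal2
  set am0 : List ℝ := m0.map (fun a => |a|) with ham0
  set am1 : List ℝ := smulR (Wt : ℝ) (m1.map fun a => |a|) with ham1
  set am2 : List ℝ := m2.map (fun c => |c| * τ ^ 2) with ham2
  set QR : List ℝ := addR (addR (mulR al0 am2) (mulR al1 am1))
    (addR (mulR al2 (addR am0 (addR am1 am2))) (mulR al1 am2)) with hQR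
  set baseR : List ℝ := smulR (Cabs : ℝ) QR with hbaseR
  set varR : List ℝ := addR (addR baseR (smulR (((Cabs * U : ℚ) : ℝ))
      (addR (addR (mulR al1 am0) (mulR al0 am1)) QR)))
    (smulR (((Cabs * U * U : ℚ) : ℝ)) (mulR (addR al0 (addR al1 al2)) (addR am0 (addR am1 am2)))) with hvarR
  -- memberships
  have p0 : PMem S al0 (absP L0) := pmem_absP hl0
  have p1 : PMem S al1 (smulQI Wu (absP L1)) := pmem_smulQI Wu rfl (pmem_absP hl1)
  have p2 : PMem S al2 (smulQI (Wu ^ 2) (absP L2)) := pmem_smulQI (Wu ^ 2) rfl (pmem_absP hl2)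
  have q0 : PMem S am0 (absP M0) := pmem_absP hm0
  have q1 : PMem S am1 (smulQI Wt (absP M1)) := pmem_smulQI Wt rfl (pmem_absP hm1)
  have pQ : PMem S QR (addI (addI (mulI S (absP L0) M2) (mulI S (smulQI Wu (absP L1)) (smulQI Wt (absP M1))))
      (addI (mulI S (smulQI (Wu ^ 2) (absP L2)) (addI (absP M0) (addI (smulQI Wt (absP M1)) M2)))
        (mulI S (smulQI Wu (absP L1)) M2))) :=
    pmem_addI (pmem_addI (pmem_mulI hS p0 hm2) (pmem_mulI hS p1 q1))
      (pmem_addI (pmem_mulI hS p2 (pmem_addI q0 (pmem_addI q1 hm2))) (pmem_mulI hS p1 hm2))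
  have pbase := pmem_smulQI Cabs (rfl : ((Cabs : ℚ) : ℝ) = Cabs) pQ
  have pvar := pmem_addI (pmem_addI pbase (pmem_smulQI (Cabs * U) (rfl : ((Cabs * U : ℚ) : ℝ) = _)
      (pmem_addI (pmem_addI (pmem_mulI hS p1 q0) (pmem_mulI hS p0 q1)) pQ)))
    (pmem_smulQI (Cabs * U * U) (rfl : ((Cabs * U * U : ℚ) : ℝ) = _)
      (pmem_mulI hS (pmem_addI p0 (pmem_addI p1 p2)) (pmem_addI q0 (pmem_addI q1 hm2))))
  -- nonnegativity
  have n0 : ∀ r ∈ al0, 0 ≤ r := nonneg_of_map_abs l0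
  have n1 : ∀ r ∈ al1, 0 ≤ r := smulR_nonneg hWu (nonneg_of_map_abs l1)
  have hWu2 : (0 : ℝ) ≤ (((Wu ^ 2 : ℚ) : ℝ)) := by push_cast; positivity
  have n2 : ∀ r ∈ al2, 0 ≤ r := smulR_nonneg hWu2 (nonneg_of_map_abs l2)
  have k0 : ∀ r ∈ am0, 0 ≤ r := nonneg_of_map_abs m0
  have k1 : ∀ r ∈ am1, 0 ≤ r := smulR_nonneg hWt (nonneg_of_map_abs m1)
  have k2 : ∀ r ∈ am2, 0 ≤ r := nonneg_of_map_abs_sq τ m2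
  have nQ : ∀ r ∈ QR, 0 ≤ r :=
    addR_nonneg (addR_nonneg (mulR_nonneg n0 k2) (mulR_nonneg n1 k1))
      (addR_nonneg (mulR_nonneg n2 (addR_nonneg k0 (addR_nonneg k1 k2))) (mulR_nonneg n1 k2))
  have nbase : ∀ r ∈ baseR, 0 ≤ r := smulR_nonneg hCn nQ
  have hCU : (0 : ℝ) ≤ (((Cabs * U : ℚ) : ℝ)) := by push_cast; positivity
  have hCUU : (0 : ℝ) ≤ (((Cabs * U * U : ℚ) : ℝ)) := by push_cast; positivity
  have nvar : ∀ r ∈ varR, 0 ≤ r :=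
    addR_nonneg (addR_nonneg nbase (smulR_nonneg hCU
      (addR_nonneg (addR_nonneg (mulR_nonneg n1 k0) (mulR_nonneg n0 k1)) nQ)))
      (smulR_nonneg hCUU (mulR_nonneg (addR_nonneg n0 (addR_nonneg n1 n2)) (addR_nonneg k0 (addR_nonneg k1 k2))))
  -- the termwise absolute bounds at m = |ρ|
  have hX0 : |evalR l0 ρ| ≤ evalR al0 |ρ| := abs_evalR_le ρ l0
  have hX1 : |δ * evalR l1 ρ| ≤ evalR al1 |ρ| := by
    rw [hal1, evalR_smulR]; exact abs_mul_le_of hδ (abs_evalR_le ρ l1)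
  have hX2 : |δ ^ 2 * evalR l2 ρ| ≤ evalR al2 |ρ| := by
    rw [hal2, evalR_smulR]
    refine abs_mul_le_of ?_ (abs_evalR_le ρ l2)
    rw [abs_pow]; push_cast; exact pow_le_pow_left₀ (abs_nonneg δ) hδ 2
  have hY0 : |evalR m0 ρ| ≤ evalR am0 |ρ| := abs_evalR_le ρ m0
  have hY1 : |τ * evalR m1 ρ| ≤ evalR am1 |ρ| := by
    rw [ham1, evalR_smulR]; exact abs_mul_le_of hτ (abs_evalR_le ρ m1)
  have hY2 : |τ ^ 2 * evalR m2 ρ| ≤ evalR am2 |ρ| := abs_sq_evalR_le τ ρ m2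
  -- evaluation of the shadows
  have eQ : evalR QR |ρ| = evalR al0 |ρ| * evalR am2 |ρ| + evalR al1 |ρ| * evalR am1 |ρ|
      + evalR al2 |ρ| * (evalR am0 |ρ| + evalR am1 |ρ| + evalR am2 |ρ|) + evalR al1 |ρ| * evalR am2 |ρ| := by
    rw [hQR]; simp only [evalR_addR, evalR_mulR]; ring
  have ebase : evalR baseR |ρ| = (Cabs : ℝ) * evalR QR |ρ| := by rw [hbaseR, evalR_smulR]
  have evar : evalR varR |ρ| = (Cabs : ℝ) * evalR QR |ρ|
      + (Cabs : ℝ) * U * (evalR al1 |ρ| * evalR am0 |ρ| + evalR al0 |ρ| * evalR am1 |ρ| + evalR QR |ρ|)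
      + (Cabs : ℝ) * U * U * ((evalR al0 |ρ| + evalR al1 |ρ| + evalR al2 |ρ|)
          * (evalR am0 |ρ| + evalR am1 |ρ| + evalR am2 |ρ|)) := by
    rw [hvarR, hbaseR]; simp only [evalR_addR, evalR_mulR, evalR_smulR]; push_cast; ring
  cases varies with
  | false =>
      obtain ⟨hu0, hr0⟩ := hvar rfl
      subst hu0; subst hr0
      refine ⟨baseR, ?_, nbase, ?_⟩
      · simp only [famRem, Bool.false_eq_true, ↓reduceIte]; exact pbase
      · have key := famRem_core (c0 := c0) (u := 0) (r2 := 0) (C := (Cabs : ℝ)) (U := 0)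
          hX0 hX1 hX2 hY0 hY1 hY2 (by simp) (by simp) hc0
        rw [remAbsR_eq_evalR, ebase, eQ]
        refine le_trans key (le_of_eq ?_)
        ring
  | true =>
      refine ⟨varR, ?_, nvar, ?_⟩
      · simp only [famRem, ↓reduceIte]; exact pvar
      · have key := famRem_core (c0 := c0) (u := u) (r2 := r2) (C := (Cabs : ℝ)) (U := (U : ℝ))
          hX0 hX1 hX2 hY0 hY1 hY2 hu hr2 hc0
        rw [remAbsR_eq_evalR, evar, eQ]
        exact key

/-- Glue to the scalar layer: `c₀ e^u = c₀(1+u) + r₂` with `|r₂| ≤ |c₀| U²` for `|u| ≤ U ≤ 1` (Mathlib's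
`Real.abs_exp_sub_one_sub_id_le`); this is the `(hc, hr2)` input of `famRem_sound` for the three varying families
(`κ`: `u = ln2·(x−y)`, `C0`: `u = 2ln2·x`, `Ct`: `u = 2ln2·y`, all with `|u| ≤ U = 2W(ln 2)⁺`). [folklore] -/
theorem scalar_exp_decomp (c0 : ℝ) {u U : ℝ} (hu : |u| ≤ U) (hU : U ≤ 1) :
    ∃ r2 : ℝ, c0 * Real.exp u = c0 * (1 + u) + r2 ∧ |r2| ≤ |c0| * U ^ 2 := by
  refine ⟨c0 * (Real.exp u - 1 - u), by ring, ?_⟩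
  rw [abs_mul]
  refine mul_le_mul_of_nonneg_left ?_ (abs_nonneg c0)
  have h1 := Real.abs_exp_sub_one_sub_id_le (le_trans hu hU)
  have h2 : u ^ 2 ≤ U ^ 2 := by
    have := pow_le_pow_left₀ (abs_nonneg u) hu 2; simpa [sq_abs] using this
  exact le_trans h1 h2

end HeadParts2

end Summit.CriticalPhenomena.Ising3D
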